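import Literature.MathematicalPhysics.QuantumFieldTheory.Balaban1983to89.B9Eq315QkSingleBondTwoBackgroundLetter
import Literature.MathematicalPhysics.QuantumFieldTheory.Balaban1983to89.B9Eq386BondPropagatorTwoBackgroundL2Tower

/-!
# `Balaban1983to89.B9Eq315QkTwoBackgroundL2Diagonal` — T. Bałaban, *Propagators for lattice gauge theories in a background field*, Commun. Math. Phys. **99** (1985) 389–434
# [Balaban1985BackgroundPropagators] (3.15)–(3.16) p. 393, (3.78)–(3.79) p. 406 *«|F₂(B)B′| ≤ O(1) sup|B| Q″|B′| … The constant O(1) above depends only on d and L»*, (3.11) p. 392,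
# with [Balaban1985Averaging] (140) p. 39 *«(Q″A)_c = Σ_{b⊂B(c₋)∪B(c₊)} L^{−d}|A_b|»*, p. 24: **THE `L²` TWO-BACKGROUND LETTER `δ_{Q,k}` OF THE COMPOSITE AVERAGING AT THE FLAT BASE,
# LATTICE-FREE ON THE CHAIN's DIAGONAL `c₀(L^{n+1})^d = c₁`** — `‖Q_k(U)f − Q_k(1)f‖_{L²(c₁)} ≤ 2d·M_φ′M_φ·L^d·2d·102(d+1)²L·(ε⋆∕(1−r))·e^{100d(d+1)L^dA}·‖f‖_{L²(c₀)}`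
# for EVERY `f`, every height `n` and every torus `m`: a Schur-type estimate from the single-bond letter (print's two-block average `Q″` of (140) is exactly the zone sum used here)

statement-level skeleton of published theorems with citation tags; proofs where landed; nothing here is a claim about the Yang–Mills mass gap

CITATION HEADER (lean-in-tree rule).  Audit cell `pub-balaban`, sub-cell `t4`, BINDER row NE9; filed by NE9 crux-team LEAF PROVER 01 (`b2b-balaban-t4-ne9-formalise-leaf-01`, gen 100;
memo `t4/b2b-balaban-t4-ne9-formalise-leaf-01/g100/ROUTE-JprimeG-BOND-STOREY-g100.md` §B5).  Imports this lineage's `B9Eq315QkSingleBondTwoBackgroundLetter` (the two-background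
spike letter `norm_QkW_sub_flat_single_le`; through it ne9-leaf-03's `B9Eq315QkSingleBondLetter.equiv_QkW_single_eq_zero`, `B9Eq383QSemiLocal.card_near_le`,
`B9Eq342TowerBigBlocks.card_sites_bigBlock_le`, `B9Eq311L2Pairing.WL2.norm_sq`) and `B9Eq386BondPropagatorTwoBackgroundL2Tower` (`equiv_finset_sum` only).  THE LOCATED GAP IT CLOSES: the owner's `B9Eq315QTowerLipschitzProfile` (M3), verbatim: *«a volume-∕
level-free `L²` operator bound for `Q_k(U) − Q_k(1)` needs a kernel (Schur-type) estimate using the locality of the composite averaging (dependence domain = one big block and its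
κ-neighbour), NOT typed here»* — typed here.  Sources READ first-hand in the held text layers (`paper:balaban1985-cmp99-background-propagators` p. 393, p. 406 (3.78)–(3.79), p. 392
(3.11); `paper:balaban1985-cmp98-averaging` p. 39 (139)–(140), p. 24).  NOTHING of print's proofs beyond the cited identities is used; [folklore] counting + Cauchy–Schwarz.

WHAT IS PROVED (sorry-free; proof lane — 0 `def`; [folklore]).
* §1 (geometry) `card_bonds_bigBlock_le` (`#{b : Π(b₋) = y} ≤ d·(L^k)^d`), **`card_zone_le`** (`#{b : Π(b₋) ∈ {c₋, c₋ + e_{c.2}}} ≤ 2d·(L^k)^d`), `sum_zone_sum_le`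
  (`Σ_c Σ_{b ∈ zone(c)} g(b) ≤ 2d·Σ_b g(b)` for `g ≥ 0` — every fine bond lies in at most `2d` zones, `card_near_le`).
* §2 (carriers, `k = n+1`) **`norm_QkW_sub_flat_apply_le_zone_sum`** — print's (3.79) with (140) at the flat base:
  `‖((Q_k(U) − Q_k(1))f)(c)‖ ≤ k_Δ·Σ_{b ∈ zone(c)} ‖f(b)‖` (`f = Σ_b δ_b^{f(b)}`; the spikes off the zone contribute `0` at BOTH backgrounds; on the zone the two-background spike
  letter `k_Δ = M_φ′·[L^d·2d·102(d+1)²L·(ε⋆∕(1−r))·((L^{n+1})^d)⁻¹e^{100d(d+1)L^dA}]·M_φ`).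
* §3 **`norm_QkW_sub_flat_le_diagonal`** — `‖Q_k(U)f − Q_k(1)f‖ ≤ 2d·(L^{n+1})^d·k_Δ·‖f‖ = 2d·M_φ′M_φ·L^d·2d·102(d+1)²L·(ε⋆∕(1−r))·e^{100d(d+1)L^dA}·‖f‖` on the diagonal
  `c₀(L^{n+1})^d = c₁`: Cauchy–Schwarz on each zone (`#zone ≤ 2dN`), the zone multiplicity `2d`, and `c₁∕c₀ = N` against the `N⁻²` of `k_Δ²` — NO power of the height, NO volume
  `|𝔅(T_m)|`, LINEAR in the closeness profile `ε⋆` (under `ε_j ≤ ε⋆r^j`, `Σ_{j≤n}α_j ≤ A`).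
HONEST SCOPE.  Counting + composition BY NAME; constants crude (`L^d`, `e^{100d(d+1)L^dA}` — NOT print's `O(1)` of (3.79)); the profiles are DISPLAYED (print's running conditions
(3.35)–(3.37)); flat base only; nothing of [B9] Thm 3.1∕3.3∕3.4 asserted; «NE9 ⇐ the named binders»; NE9 NOT PRINTED ∕ NOT PROVED; row WALLED ON A MODEL (O-NE9-1; #5 UNRULED); spine
PROVED 0∕9; rung (B)+1 on a finite T⁴ — NOT infinite volume, NOT mass gap, NOT BetaPertH, NOT Clay.  HONEST DEPENDENCY: continuum YM on T⁴ ⇐ BetaPertH ∧ nine spine estimates (0/9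
proved); BetaPertH ⇐ (D1) ∧ (D4) ∧ CAP+tail; G-an2-4 gates asym, D1 and NE2/3/4.  NEW file; nothing modified.  Net new unproved facts: 0.
-/

noncomputable section

open scoped BigOperators

namespace Literature.MathematicalPhysics.QuantumFieldTheory.Balaban1983to89.B9Eq315QkTwoBackgroundL2Diagonal

open B4Sect5Torus (TSite)
open B9SectCLatticeCarrier (Bond shift)
open B9Eq311L2Pairing (WL2)
open B11Eq103H1Complex (BondL2K)
open B9Eq319QprimeTorus (fineP blockCoord)
open B7Prop1Explicit (U1 Wcx boxVec)
open B9Eq315QTorus (perCfg cornerSite)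
open B9Eq315QTower (towerP UlevOf)
open B9Eq315QTowerFlat (perCfg_UlevOf_one_mem_U1 norm_Wcx_UlevOf_one_sub_one_le)
open B9Eq316TowerFlatIsOneStep (towerP_eq_fineP_pow siteCast)
open B9Eq326OperatorTower (QkW)
open B9Eq342TowerBigBlocks (card_sites_bigBlock_le)
open B9Eq383QSemiLocal (card_near_le)
open B9Eq315QkSingleBondLetter (equiv_QkW_single_eq_zero)
open B9Eq315QkSingleBondTwoBackgroundLetter (norm_QkW_sub_flat_single_le)
open B9Eq386BondPropagatorTwoBackgroundL2Tower (equiv_finset_sum)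

/-! ## §1 Geometry: the zone of a coarse bond holds at most `2d·(L^k)^d` fine bonds, and every fine bond lies in at most `2d` zones -/

section Geometry

variable {d : ℕ} (L : ℕ) [NeZero L] (m : Fin d → ℕ) [∀ i, NeZero (m i)] (k : ℕ)

omit [∀ i, NeZero (m i)] in
/-- the fine bonds based in a big block: `#{b : Π(b₋) = y} ≤ d·(L^k)^d`. [folklore] [cite: Balaban1985Averaging, (2) p.17; Balaban1985BackgroundPropagators, (3.15) p.393] -/
theorem card_bonds_bigBlock_le (y : TSite d m) :
    (Finset.univ.filter (fun b : Bond d (towerP L m k) => blockCoord (L ^ k) m (siteCast (towerP_eq_fineP_pow L m k) b.1) = y)).card ≤ d * (L ^ k) ^ d := by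
  classical
  have h : Finset.univ.filter (fun b : Bond d (towerP L m k) => blockCoord (L ^ k) m (siteCast (towerP_eq_fineP_pow L m k) b.1) = y) =
      (Finset.univ.filter (fun x : TSite d (towerP L m k) => blockCoord (L ^ k) m (siteCast (towerP_eq_fineP_pow L m k) x) = y)) ×ˢ
        (Finset.univ : Finset (Fin d)) := by
    ext b
    simp only [Finset.mem_filter, Finset.mem_univ, true_and, Finset.mem_product, and_true]
  rw [h, Finset.card_product, Finset.card_univ, Fintype.card_fin, mul_comm]
  exact Nat.mul_le_mul_left d (card_sites_bigBlock_le L m k y)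

omit [∀ i, NeZero (m i)] in
/-- **THE ZONE OF A COARSE BOND** `c` — the fine bonds `b` with `Π(b₋) ∈ {c₋, c₋ + e_{c.2}}` (print's `b ⊂ B(c₋) ∪ B(c₊)` of (140)) — **HOLDS AT MOST `2d·(L^k)^d` FINE BONDS**. [folklore]
[cite: Balaban1985Averaging, (140) p.39, p.24; Balaban1985BackgroundPropagators, (3.15) p.393] -/
theorem card_zone_le (c : Bond d m) :
    (Finset.univ.filter (fun b : Bond d (towerP L m k) =>
        blockCoord (L ^ k) m (siteCast (towerP_eq_fineP_pow L m k) b.1) = c.1 ∨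
          blockCoord (L ^ k) m (siteCast (towerP_eq_fineP_pow L m k) b.1) = shift c.2 c.1)).card ≤ 2 * d * (L ^ k) ^ d := by
  classical
  rw [Finset.filter_or]
  refine (Finset.card_union_le _ _).trans ?_
  have h1 := card_bonds_bigBlock_le L m k c.1
  have h2 := card_bonds_bigBlock_le L m k (shift c.2 c.1)
  calc _ ≤ d * (L ^ k) ^ d + d * (L ^ k) ^ d := add_le_add h1 h2
    _ = 2 * d * (L ^ k) ^ d := by ring

omit [NeZero L] [∀ i, NeZero (m i)] in
/-- **EVERY FINE BOND LIES IN AT MOST `2d` ZONES**: `Σ_c Σ_{b ∈ zone(c)} g(b) ≤ 2d·Σ_b g(b)` for `g ≥ 0` (`card_near_le`). [folklore]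
[cite: Balaban1985Averaging, (140) p.39, p.24; Balaban1985BackgroundPropagators, (3.15) p.393] -/
theorem sum_zone_sum_le {g : Bond d (towerP L m k) → ℝ} (hg : ∀ b, 0 ≤ g b) :
    ∑ c : Bond d m, ∑ b ∈ Finset.univ.filter (fun b : Bond d (towerP L m k) =>
        blockCoord (L ^ k) m (siteCast (towerP_eq_fineP_pow L m k) b.1) = c.1 ∨
          blockCoord (L ^ k) m (siteCast (towerP_eq_fineP_pow L m k) b.1) = shift c.2 c.1), g b ≤ 2 * d * ∑ b, g b := by
  classical
  calc ∑ c : Bond d m, ∑ b ∈ Finset.univ.filter (fun b : Bond d (towerP L m k) =>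
          blockCoord (L ^ k) m (siteCast (towerP_eq_fineP_pow L m k) b.1) = c.1 ∨
            blockCoord (L ^ k) m (siteCast (towerP_eq_fineP_pow L m k) b.1) = shift c.2 c.1), g b
      = ∑ c : Bond d m, ∑ b : Bond d (towerP L m k),
          (if blockCoord (L ^ k) m (siteCast (towerP_eq_fineP_pow L m k) b.1) = c.1 ∨
              blockCoord (L ^ k) m (siteCast (towerP_eq_fineP_pow L m k) b.1) = shift c.2 c.1 then g b else 0) :=
        Finset.sum_congr rfl fun c _ => Finset.sum_filter _ _
    _ = ∑ b : Bond d (towerP L m k), ∑ c : Bond d m,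
          (if blockCoord (L ^ k) m (siteCast (towerP_eq_fineP_pow L m k) b.1) = c.1 ∨
              blockCoord (L ^ k) m (siteCast (towerP_eq_fineP_pow L m k) b.1) = shift c.2 c.1 then g b else 0) := Finset.sum_comm
    _ ≤ ∑ b : Bond d (towerP L m k), 2 * d * g b := by
        refine Finset.sum_le_sum fun b _ => ?_
        rw [← Finset.sum_filter, Finset.sum_const, nsmul_eq_mul]
        have h := card_near_le m (blockCoord (L ^ k) m (siteCast (towerP_eq_fineP_pow L m k) b.1))
        have h' : ((Finset.univ.filter (fun c : Bond d m => blockCoord (L ^ k) m (siteCast (towerP_eq_fineP_pow L m k) b.1) = c.1 ∨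
            blockCoord (L ^ k) m (siteCast (towerP_eq_fineP_pow L m k) b.1) = shift c.2 c.1)).card : ℝ) ≤ 2 * d := by exact_mod_cast h
        exact mul_le_mul_of_nonneg_right h' (hg b)
    _ = 2 * d * ∑ b, g b := by rw [Finset.mul_sum]

end Geometry

/-! ## §2 The pointwise zone-sum letter of `Q_k(U) − Q_k(1)` on the carriers -/

section Carrier

variable {d : ℕ} (L : ℕ) [NeZero L] (m : Fin d → ℕ) [∀ i, NeZero (m i)] (n : ℕ)
  {𝔸 : Type*} [NormedRing 𝔸] [NormedAlgebra ℂ 𝔸] [CompleteSpace 𝔸] [NormOneClass 𝔸]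
  {W : Type*} [NormedAddCommGroup W] [InnerProductSpace ℂ W] (φ : W ≃ₗ[ℂ] 𝔸) {c₀ c₁ : ℝ} [Fact (0 < c₀)] [Fact (0 < c₁)]
  (U : Bond d (towerP L m (n + 1)) → 𝔸ˣ) (hL : 1 ≤ L) (α : ℕ → ℝ) (hα0 : ∀ j, 0 ≤ α j) (hα1 : ∀ j, α j ≤ 1 / 64)
  (hU1 : ∀ (j : ℕ) (x : B7Prop1Explicit.Site d) (κ : Fin d), perCfg (towerP L m (j + 1)) (UlevOf L m (n + 1) U j) x κ ∈ U1 𝔸)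
  (hreg : ∀ (j : ℕ) (y : TSite d (towerP L m j)) (κ : Fin d) (r : Fin d → Fin L),
    ‖((Wcx L (perCfg (towerP L m (j + 1)) (UlevOf L m (n + 1) U j)) (cornerSite L y) κ (boxVec L r) : 𝔸ˣ) : 𝔸) - 1‖ ≤ α j)
  (εU : ℕ → ℝ) (hεU : ∀ j, 0 ≤ εU j) (hUε : ∀ (j : ℕ) (b : Bond d (towerP L m (j + 1))), ‖(UlevOf L m (n + 1) U j b : 𝔸) - 1‖ ≤ εU j)
  {r εs : ℝ} (hr0 : 0 ≤ r) (hr1 : r < 1) (hεs : 0 ≤ εs) (hεg : ∀ j < n + 1, εU j ≤ εs * r ^ j)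
  {Mφ Mφ' : ℝ} (hMφ : 0 ≤ Mφ) (hφ : ∀ w, ‖φ w‖ ≤ Mφ * ‖w‖) (hMφ' : 0 ≤ Mφ') (hφ' : ∀ X, ‖φ.symm X‖ ≤ Mφ' * ‖X‖)

include hα0 hεU hUε hr0 hr1 hεs hεg hφ hMφ' hφ' in
omit [Fact (0 < c₀)] [Fact (0 < c₁)] in
/-- **THE POINTWISE ZONE-SUM LETTER** (print's (3.79) «|F₂(B)B′| ≤ O(1) sup|B| Q″|B′|» with (140)'s two-block sum, at the flat base): for EVERY `f` and every coarse bond `c`,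
`‖((Q_k(U) − Q_k(1))f)(c)‖ ≤ k_Δ·Σ_{b ∈ zone(c)} ‖f(b)‖` — `f = Σ_b δ_b^{f(b)}`; a spike based off the zone of `c` contributes `0` at both backgrounds
(`equiv_QkW_single_eq_zero`), one on the zone at most `k_Δ‖f(b)‖` (`norm_QkW_sub_flat_single_le`). [folklore]
[cite: Balaban1985BackgroundPropagators, (3.15)–(3.16) p.393, (3.78)–(3.79) p.406; Balaban1985Averaging, (140) p.39, p.24] -/
theorem norm_QkW_sub_flat_apply_le_zone_sum {A : ℝ} (hA : ∑ j ∈ Finset.range (n + 1), α j ≤ A)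
    (f : BondL2K ℂ d (towerP L m (n + 1)) c₀ W) (c : Bond d m) :
    ‖WL2.equiv ℂ (fun _ : Bond d m => c₁) W (QkW L m n φ U hL α hα1 hU1 hreg (c₀ := c₀) (c₁ := c₁) f) c -
        WL2.equiv ℂ (fun _ : Bond d m => c₁) W (QkW L m n φ (fun _ : Bond d (towerP L m (n + 1)) => (1 : 𝔸ˣ)) hL (fun _ => 0) (fun _ => by norm_num)
          (perCfg_UlevOf_one_mem_U1 L m (n + 1)) (norm_Wcx_UlevOf_one_sub_one_le L m (n + 1) (fun _ => 0) (fun _ => le_rfl)) (c₀ := c₀) (c₁ := c₁) f) c‖ ≤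
      (Mφ' * ((L : ℝ) ^ d * (2 * d * (102 * (d + 1) ^ 2 * L)) * (εs / (1 - r)) *
        ((((L : ℝ) ^ (n + 1)) ^ d)⁻¹ * Real.exp (100 * d * (d + 1) * (L : ℝ) ^ d * A))) * Mφ) *
      ∑ b ∈ Finset.univ.filter (fun b : Bond d (towerP L m (n + 1)) =>
          blockCoord (L ^ (n + 1)) m (siteCast (towerP_eq_fineP_pow L m (n + 1)) b.1) = c.1 ∨
            blockCoord (L ^ (n + 1)) m (siteCast (towerP_eq_fineP_pow L m (n + 1)) b.1) = shift c.2 c.1),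
        ‖WL2.equiv ℂ (fun _ : Bond d (towerP L m (n + 1)) => c₀) W f b‖ := by
  classical
  -- the spike decomposition of the source
  have hf : f = ∑ b, (WL2.equiv ℂ (fun _ : Bond d (towerP L m (n + 1)) => c₀) W).symm
      (Pi.single b (WL2.equiv ℂ (fun _ : Bond d (towerP L m (n + 1)) => c₀) W f b)) := by
    apply (WL2.equiv ℂ (fun _ : Bond d (towerP L m (n + 1)) => c₀) W).injective
    funext x
    rw [equiv_finset_sum]
    simp only [Equiv.apply_symm_apply]
    rw [← Finset.sum_apply, Finset.univ_sum_single]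
  have hT : WL2.equiv ℂ (fun _ : Bond d m => c₁) W (QkW L m n φ U hL α hα1 hU1 hreg (c₀ := c₀) (c₁ := c₁) f) c -
      WL2.equiv ℂ (fun _ : Bond d m => c₁) W (QkW L m n φ (fun _ : Bond d (towerP L m (n + 1)) => (1 : 𝔸ˣ)) hL (fun _ => 0) (fun _ => by norm_num)
        (perCfg_UlevOf_one_mem_U1 L m (n + 1)) (norm_Wcx_UlevOf_one_sub_one_le L m (n + 1) (fun _ => 0) (fun _ => le_rfl)) (c₀ := c₀) (c₁ := c₁) f) c =
      ∑ b, (WL2.equiv ℂ (fun _ : Bond d m => c₁) W (QkW L m n φ U hL α hα1 hU1 hreg (c₀ := c₀) (c₁ := c₁)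
          ((WL2.equiv ℂ (fun _ : Bond d (towerP L m (n + 1)) => c₀) W).symm
            (Pi.single b (WL2.equiv ℂ (fun _ : Bond d (towerP L m (n + 1)) => c₀) W f b)))) c -
        WL2.equiv ℂ (fun _ : Bond d m => c₁) W (QkW L m n φ (fun _ : Bond d (towerP L m (n + 1)) => (1 : 𝔸ˣ)) hL (fun _ => 0) (fun _ => by norm_num)
          (perCfg_UlevOf_one_mem_U1 L m (n + 1)) (norm_Wcx_UlevOf_one_sub_one_le L m (n + 1) (fun _ => 0) (fun _ => le_rfl)) (c₀ := c₀) (c₁ := c₁)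
          ((WL2.equiv ℂ (fun _ : Bond d (towerP L m (n + 1)) => c₀) W).symm
            (Pi.single b (WL2.equiv ℂ (fun _ : Bond d (towerP L m (n + 1)) => c₀) W f b)))) c) := by
    conv_lhs => rw [hf]
    simp only [map_sum]
    rw [equiv_finset_sum, equiv_finset_sum, ← Finset.sum_sub_distrib]
  rw [hT]
  refine (norm_sum_le _ _).trans ?_
  have hb : ∀ b : Bond d (towerP L m (n + 1)),
      ‖WL2.equiv ℂ (fun _ : Bond d m => c₁) W (QkW L m n φ U hL α hα1 hU1 hreg (c₀ := c₀) (c₁ := c₁)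
          ((WL2.equiv ℂ (fun _ : Bond d (towerP L m (n + 1)) => c₀) W).symm
            (Pi.single b (WL2.equiv ℂ (fun _ : Bond d (towerP L m (n + 1)) => c₀) W f b)))) c -
        WL2.equiv ℂ (fun _ : Bond d m => c₁) W (QkW L m n φ (fun _ : Bond d (towerP L m (n + 1)) => (1 : 𝔸ˣ)) hL (fun _ => 0) (fun _ => by norm_num)
          (perCfg_UlevOf_one_mem_U1 L m (n + 1)) (norm_Wcx_UlevOf_one_sub_one_le L m (n + 1) (fun _ => 0) (fun _ => le_rfl)) (c₀ := c₀) (c₁ := c₁)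
          ((WL2.equiv ℂ (fun _ : Bond d (towerP L m (n + 1)) => c₀) W).symm
            (Pi.single b (WL2.equiv ℂ (fun _ : Bond d (towerP L m (n + 1)) => c₀) W f b)))) c‖ ≤
      if blockCoord (L ^ (n + 1)) m (siteCast (towerP_eq_fineP_pow L m (n + 1)) b.1) = c.1 ∨
          blockCoord (L ^ (n + 1)) m (siteCast (towerP_eq_fineP_pow L m (n + 1)) b.1) = shift c.2 c.1 then
        (Mφ' * ((L : ℝ) ^ d * (2 * d * (102 * (d + 1) ^ 2 * L)) * (εs / (1 - r)) *
          ((((L : ℝ) ^ (n + 1)) ^ d)⁻¹ * Real.exp (100 * d * (d + 1) * (L : ℝ) ^ d * A))) * Mφ) *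
          ‖WL2.equiv ℂ (fun _ : Bond d (towerP L m (n + 1)) => c₀) W f b‖
      else 0 := by
    intro b
    by_cases hz : blockCoord (L ^ (n + 1)) m (siteCast (towerP_eq_fineP_pow L m (n + 1)) b.1) = c.1 ∨
        blockCoord (L ^ (n + 1)) m (siteCast (towerP_eq_fineP_pow L m (n + 1)) b.1) = shift c.2 c.1
    · rw [if_pos hz]
      exact norm_QkW_sub_flat_single_le L m n φ U hL α hα0 hα1 hU1 hreg εU hεU hUε hr0 hr1 hεs hεg hφ hMφ' hφ' hA b _ c
    · rw [if_neg hz]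
      simp only [not_or] at hz
      rw [equiv_QkW_single_eq_zero L m n φ U hL α hα1 hU1 hreg b _ c (Ne.symm hz.1) (Ne.symm hz.2),
        equiv_QkW_single_eq_zero L m n φ _ hL _ _ _ _ b _ c (Ne.symm hz.1) (Ne.symm hz.2), sub_zero, norm_zero]
  refine (Finset.sum_le_sum fun b _ => hb b).trans (le_of_eq ?_)
  rw [← Finset.sum_filter, Finset.mul_sum]

/-! ## §3 `δ_{Q,k}` in `L²` on the diagonal, lattice-free -/

include hα0 hεU hUε hr0 hr1 hεs hεg hMφ hφ hMφ' hφ' in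
/-- **THE `L²` TWO-BACKGROUND LETTER OF `Q_k` AT THE FLAT BASE, LATTICE-FREE ON THE DIAGONAL `c₀(L^{n+1})^d = c₁`**: under the profiles `ε_j ≤ ε⋆r^j` (`j ≤ n`), `Σ_{j≤n} α_j ≤ A`,
for EVERY `f` of the weight-`c₀` fine bond carrier, `‖Q_k(U)f − Q_k(1)f‖_{L²(c₁)} ≤ 2d·M_φ′M_φ·L^d·2d·102(d+1)²L·(ε⋆∕(1−r))·e^{100d(d+1)L^dA}·‖f‖_{L²(c₀)}` — Cauchy–Schwarz on
each zone (`#zone ≤ 2d·(L^{n+1})^d`, `card_zone_le`), the zone multiplicity `2d` (`sum_zone_sum_le`), and `c₁∕c₀ = (L^{n+1})^d` against the `(L^{n+1})^{−2d}` of `k_Δ²`.  NO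
power of the height, NO volume of the torus — the kernel (Schur-type) estimate the owner's `B9Eq315QTowerLipschitzProfile` (M3) located. [folklore]
[cite: Balaban1985BackgroundPropagators, (3.15)–(3.16) p.393, (3.78)–(3.79) p.406, (3.11) p.392, (3.35)–(3.37) p.396; Balaban1985Averaging, (139)–(140) p.39, p.24] -/
theorem norm_QkW_sub_flat_le_diagonal {A : ℝ} (hA : ∑ j ∈ Finset.range (n + 1), α j ≤ A) (hw : c₀ * ((L : ℝ) ^ (n + 1)) ^ d = c₁)
    (f : BondL2K ℂ d (towerP L m (n + 1)) c₀ W) :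
    ‖QkW L m n φ U hL α hα1 hU1 hreg (c₀ := c₀) (c₁ := c₁) f -
        QkW L m n φ (fun _ : Bond d (towerP L m (n + 1)) => (1 : 𝔸ˣ)) hL (fun _ => 0) (fun _ => by norm_num)
          (perCfg_UlevOf_one_mem_U1 L m (n + 1)) (norm_Wcx_UlevOf_one_sub_one_le L m (n + 1) (fun _ => 0) (fun _ => le_rfl)) (c₀ := c₀) (c₁ := c₁) f‖ ≤
      2 * d * (Mφ' * Mφ * ((L : ℝ) ^ d * (2 * d * (102 * (d + 1) ^ 2 * L)) * (εs / (1 - r)) * Real.exp (100 * d * (d + 1) * (L : ℝ) ^ d * A))) * ‖f‖ := by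
  classical
  have hc₀ : (0 : ℝ) < c₀ := Fact.out
  have hc₁ : (0 : ℝ) < c₁ := Fact.out
  have hLpos : (0 : ℝ) < L := by exact_mod_cast hL
  have h1r : 0 < 1 - r := by linarith
  set N : ℝ := ((L : ℝ) ^ (n + 1)) ^ d with hN
  have hN0 : 0 < N := by positivity
  set kΔ : ℝ := Mφ' * ((L : ℝ) ^ d * (2 * d * (102 * (d + 1) ^ 2 * L)) * (εs / (1 - r)) *
    (N⁻¹ * Real.exp (100 * d * (d + 1) * (L : ℝ) ^ d * A))) * Mφ with hkΔ
  have hkΔ0 : 0 ≤ kΔ := by positivity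
  set K : ℝ := 2 * d * (Mφ' * Mφ * ((L : ℝ) ^ d * (2 * d * (102 * (d + 1) ^ 2 * L)) * (εs / (1 - r)) * Real.exp (100 * d * (d + 1) * (L : ℝ) ^ d * A)))
    with hK
  have hK0 : 0 ≤ K := by positivity
  have hKeq : 2 * d * N * kΔ = K := by
    rw [hK, hkΔ]; field_simp
  set g := QkW L m n φ U hL α hα1 hU1 hreg (c₀ := c₀) (c₁ := c₁) f -
    QkW L m n φ (fun _ : Bond d (towerP L m (n + 1)) => (1 : 𝔸ˣ)) hL (fun _ => 0) (fun _ => by norm_num)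
      (perCfg_UlevOf_one_mem_U1 L m (n + 1)) (norm_Wcx_UlevOf_one_sub_one_le L m (n + 1) (fun _ => 0) (fun _ => le_rfl)) (c₀ := c₀) (c₁ := c₁) f with hg
  set Z : Bond d m → Finset (Bond d (towerP L m (n + 1))) := fun c => Finset.univ.filter (fun b : Bond d (towerP L m (n + 1)) =>
    blockCoord (L ^ (n + 1)) m (siteCast (towerP_eq_fineP_pow L m (n + 1)) b.1) = c.1 ∨
      blockCoord (L ^ (n + 1)) m (siteCast (towerP_eq_fineP_pow L m (n + 1)) b.1) = shift c.2 c.1) with hZ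
  -- (1) pointwise: Cauchy–Schwarz on the zone
  have hpt : ∀ c : Bond d m, ‖WL2.equiv ℂ (fun _ : Bond d m => c₁) W g c‖ ^ 2 ≤
      kΔ ^ 2 * (2 * d * N) * ∑ b ∈ Z c, ‖WL2.equiv ℂ (fun _ : Bond d (towerP L m (n + 1)) => c₀) W f b‖ ^ 2 := by
    intro c
    have h1 : ‖WL2.equiv ℂ (fun _ : Bond d m => c₁) W g c‖ ≤ kΔ * ∑ b ∈ Z c, ‖WL2.equiv ℂ (fun _ : Bond d (towerP L m (n + 1)) => c₀) W f b‖ := by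
      rw [hg, WL2.equiv_sub, Pi.sub_apply]
      exact norm_QkW_sub_flat_apply_le_zone_sum L m n φ U hL α hα0 hα1 hU1 hreg εU hεU hUε hr0 hr1 hεs hεg hφ hMφ' hφ' hA f c
    have h2 : (∑ b ∈ Z c, ‖WL2.equiv ℂ (fun _ : Bond d (towerP L m (n + 1)) => c₀) W f b‖) ^ 2 ≤
        (Z c).card * ∑ b ∈ Z c, ‖WL2.equiv ℂ (fun _ : Bond d (towerP L m (n + 1)) => c₀) W f b‖ ^ 2 := sq_sum_le_card_mul_sum_sq
    have h3 : ((Z c).card : ℝ) ≤ 2 * d * N := by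
      have h := card_zone_le L m (n + 1) c
      rw [hN]; exact_mod_cast h
    have hS0 : 0 ≤ ∑ b ∈ Z c, ‖WL2.equiv ℂ (fun _ : Bond d (towerP L m (n + 1)) => c₀) W f b‖ ^ 2 := Finset.sum_nonneg fun b _ => by positivity
    calc ‖WL2.equiv ℂ (fun _ : Bond d m => c₁) W g c‖ ^ 2
        ≤ (kΔ * ∑ b ∈ Z c, ‖WL2.equiv ℂ (fun _ : Bond d (towerP L m (n + 1)) => c₀) W f b‖) ^ 2 := pow_le_pow_left₀ (norm_nonneg _) h1 2
      _ = kΔ ^ 2 * (∑ b ∈ Z c, ‖WL2.equiv ℂ (fun _ : Bond d (towerP L m (n + 1)) => c₀) W f b‖) ^ 2 := by ring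
      _ ≤ kΔ ^ 2 * (((Z c).card : ℝ) * ∑ b ∈ Z c, ‖WL2.equiv ℂ (fun _ : Bond d (towerP L m (n + 1)) => c₀) W f b‖ ^ 2) :=
          mul_le_mul_of_nonneg_left h2 (sq_nonneg _)
      _ ≤ kΔ ^ 2 * ((2 * d * N) * ∑ b ∈ Z c, ‖WL2.equiv ℂ (fun _ : Bond d (towerP L m (n + 1)) => c₀) W f b‖ ^ 2) :=
          mul_le_mul_of_nonneg_left (mul_le_mul_of_nonneg_right h3 hS0) (sq_nonneg _)
      _ = _ := by ring
  -- (2) the weighted sum over the coarse bonds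
  have hf2 : ‖f‖ ^ 2 = ∑ b, c₀ * ‖WL2.equiv ℂ (fun _ : Bond d (towerP L m (n + 1)) => c₀) W f b‖ ^ 2 := WL2.norm_sq f
  have hsq : ‖g‖ ^ 2 ≤ (K * ‖f‖) ^ 2 := by
    have hzone := sum_zone_sum_le L m (n + 1) (g := fun b => ‖WL2.equiv ℂ (fun _ : Bond d (towerP L m (n + 1)) => c₀) W f b‖ ^ 2) (fun b => sq_nonneg _)
    rw [WL2.norm_sq]
    calc ∑ c, c₁ * ‖WL2.equiv ℂ (fun _ : Bond d m => c₁) W g c‖ ^ 2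
        ≤ ∑ c, c₁ * (kΔ ^ 2 * (2 * d * N) * ∑ b ∈ Z c, ‖WL2.equiv ℂ (fun _ : Bond d (towerP L m (n + 1)) => c₀) W f b‖ ^ 2) :=
          Finset.sum_le_sum fun c _ => mul_le_mul_of_nonneg_left (hpt c) hc₁.le
      _ = c₁ * (kΔ ^ 2 * (2 * d * N)) * ∑ c, ∑ b ∈ Z c, ‖WL2.equiv ℂ (fun _ : Bond d (towerP L m (n + 1)) => c₀) W f b‖ ^ 2 := by
          rw [Finset.mul_sum]; exact Finset.sum_congr rfl fun c _ => by ring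
      _ ≤ c₁ * (kΔ ^ 2 * (2 * d * N)) * (2 * d * ∑ b, ‖WL2.equiv ℂ (fun _ : Bond d (towerP L m (n + 1)) => c₀) W f b‖ ^ 2) :=
          mul_le_mul_of_nonneg_left hzone (by positivity)
      _ = (2 * d * N * kΔ) ^ 2 * (c₀ * ∑ b, ‖WL2.equiv ℂ (fun _ : Bond d (towerP L m (n + 1)) => c₀) W f b‖ ^ 2) := by rw [← hw]; ring
      _ = K ^ 2 * ‖f‖ ^ 2 := by rw [hKeq, Finset.mul_sum, hf2]
      _ = (K * ‖f‖) ^ 2 := by ring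
  exact le_of_pow_le_pow_left₀ two_ne_zero (by positivity) hsq

end Carrier

end Literature.MathematicalPhysics.QuantumFieldTheory.Balaban1983to89.B9Eq315QkTwoBackgroundL2Diagonal

end
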